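import Summits.SmoothPoincare4.SmoothPoincare4.Theses.CongruenceShadows
import Summits.SmoothPoincare4.SmoothPoincare4.Theorems.CongruenceShadowsAbelianShadowStandard
import HarnessLib

/-!
# Stub `stub_abelianGenusClass` of line `nilpotent-genus-class` for crux `CongruenceShadows.ShadowApproximation`
(item stmt-SmoothPoincare4-14595, route route-SmoothPoincare4-CongruenceShadows) — the abelian level

Notation: `S = SurfaceGroup (3+3m)` (the surface group of genus `3+3m`), `N = s4Kernels.stabilizeIter m`
(the standard kernel triple of the genus-`3+3m` trisection of `S⁴`), `γ₂ = (⊤ : Subgroup S).lowerCentralSeries 1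
= [S,S]` (the abelian level of the lower central series).

**`stub_abelianGenusClass`** (registered, proved verbatim): for every `(3+3m; m+1)` group trisection `K` of
the trivial group (`IsGroupTrisection (3+3m) (m+1) PUnit K`) which is slot-normalised, `K 0 = N 0` and
`K 1 = N 1`, there is an automorphism `φ` of `S` with `φ(N 0 ⊔ γ₂) = N 0 ⊔ γ₂`, `φ(N 1 ⊔ γ₂) = N 1 ⊔ γ₂`
and `φ(N 2 ⊔ γ₂) = K 2 ⊔ γ₂`.

Proof.  This is literally the landed route item `AbelianShadowStandard` (item stmt-SmoothPoincare4-14599),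
`Theorems.AbelianShadowStandard.abelianShadowStandard_proof`: some `ψ ∈ Aut S` has
`ψ(N i ⊔ γ₂) = K i ⊔ γ₂` for `i = 0, 1, 2`; with `K 0 = N 0`, `K 1 = N 1` the first two equations are
the required stabilisation of slots `0, 1`, the third is slot `2` as stated.  No new definitions, no named
facts (unconditional).
-/

-- the prescribed namespace `Summit.<P>.<Sub>.…` duplicates `SmoothPoincare4` (P = Sub)
set_option linter.dupNamespace false
noncomputable section
open Literature.Topology.FourManifolds Literature.Algebra.Lie Multiplicative

namespace Summit.SmoothPoincare4.SmoothPoincare4.Theorems.ShadowApproximation.NilpotentGenusClass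

/-! ## The stub -/

/-- **Stub `stub_abelianGenusClass`** (line `nilpotent-genus-class`, the abelian level "ArithGate₀"):
for a slot-normalised `(3+3m; m+1)` group trisection `K = (N 0, N 1, K 2)` of the trivial group there is
`φ ∈ Aut S_{3+3m}` stabilising `N 0 ⊔ [S,S]` and `N 1 ⊔ [S,S]` and carrying `N 2 ⊔ [S,S]` onto
`K 2 ⊔ [S,S]` (`N = s4Kernels.stabilizeIter m`).  Immediate specialisation of the landed route item
`AbelianShadowStandard` (`abelianShadowStandard_proof`) to `K 0 = N 0`, `K 1 = N 1`. [folklore] -/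
theorem stub_abelianGenusClass :
    ∀ (m : ℕ) (K : TrisectionKernels (3 + 3 * m)),
      IsGroupTrisection (3 + 3 * m) (m + 1) (PUnit : Type) K →
      K 0 = s4Kernels.stabilizeIter m 0 → K 1 = s4Kernels.stabilizeIter m 1 →
      ∃ φ : SurfaceGroup (3 + 3 * m) ≃* SurfaceGroup (3 + 3 * m),
        (s4Kernels.stabilizeIter m 0 ⊔ (⊤ : Subgroup (SurfaceGroup (3 + 3 * m))).lowerCentralSeries 1).map
            φ.toMonoidHom =
          s4Kernels.stabilizeIter m 0 ⊔ (⊤ : Subgroup (SurfaceGroup (3 + 3 * m))).lowerCentralSeries 1 ∧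
        (s4Kernels.stabilizeIter m 1 ⊔ (⊤ : Subgroup (SurfaceGroup (3 + 3 * m))).lowerCentralSeries 1).map
            φ.toMonoidHom =
          s4Kernels.stabilizeIter m 1 ⊔ (⊤ : Subgroup (SurfaceGroup (3 + 3 * m))).lowerCentralSeries 1 ∧
        (s4Kernels.stabilizeIter m 2 ⊔ (⊤ : Subgroup (SurfaceGroup (3 + 3 * m))).lowerCentralSeries 1).map
            φ.toMonoidHom =
          K 2 ⊔ (⊤ : Subgroup (SurfaceGroup (3 + 3 * m))).lowerCentralSeries 1 := by
  intro m K hK h0 h1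
  obtain ⟨ψ, hψ⟩ :=
    Summit.SmoothPoincare4.SmoothPoincare4.Theorems.AbelianShadowStandard.abelianShadowStandard_proof m K hK
  have e0 := hψ 0
  have e1 := hψ 1
  rw [h0] at e0
  rw [h1] at e1
  exact ⟨ψ, e0, e1, hψ 2⟩

end Summit.SmoothPoincare4.SmoothPoincare4.Theorems.ShadowApproximation.NilpotentGenusClass

end
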